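import Summits.BirchSwinnertonDyer.BirchSwinnertonDyer.Theorems.RamifiedHeegnerPairWAllExclAddGssAtThreeColumnAssemblyTwistUnitsNonsplit
import Literature.NumberTheory.EllipticCurves.MatarNekovar2019.ShaStructureIrreducible
import Literature.NumberTheory.EllipticCurves.ZywinaCMImageProofs
import Literature.NumberTheory.EllipticCurves.BSDSelmerPConverseRankOneRubinProofs
import HarnessLib

/-!
# Route `RamifiedHeegnerPair`, crux A `Gss2RankOneMcCallumCertificateAtThree{Tower}` (stmt-BirchSwinnertonDyer-27200, the LOAD-BEARING stub of
# the L₁ line `kolyvagin_split`) is TIGHT: it FOLLOWS from BSD₃ on the leaf modulo print — the kernel LOSS ANALYSIS of the line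

HONEST FRAMING. Theorems only (no definition, no named fact, no `sorry`); helper file; nothing is booked, no item is closed, BSD is not proved
for any curve. Lead prover bsd-line-rhp-p1 g7 (L₁ lead), 2026-08-28. This file proves the CONVERSE of the line's road: the research stubs A 27200
(tower rows) and A₃ₙₙ (`3Nn` rows) — «per Gss2 rank-one row SOME split Heegner frame carries SOME derived-Heegner-point certificate
`Koly.CertificateAt Dt β ι 3 M` with `2M ≤ ord₃∏c(E) + ord₃∏c(Wd) + 2·ord₃ c(Dt)`» — FOLLOW from the four member halves of the route (L₁ 26021,
U₁ 26022, L₀ 26023, U₀ 26024), hence from the leaf `WAllExclAddGssAtThree`, modulo the PRINTED facts the road already displays (Gross–Zagier,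
Kolyvagin, GZK, modularity, newforms, Hoffstein–Luo, Shimura reciprocity at conductor `1`, Darmon Thm. 3.6, the modular parametrisation, BOTH
Matar–Nekovář 2019 Thm. 0.7/§0.11 halves of Kolyvagin's structure theorem under irreducibility). So A has NO SURPLUS over the leaf: modulo
print `A ∧ U₀ ⟹ L₁|tower` (p618012 §12) and `leaf ⟹ A` (here) — the card's LOSS ANALYSIS, kernel-checked (pen criterion (ii)).

ARGUMENT (`M₀ = ord₃[E(K):ℤy_K]`, budget `b := ord₃∏c(E) + ord₃∏c(Wd) + 2·ord₃ c(Dt)`, `M := ⌊b/2⌋`). At a split frame with `L(E^{(d_K)},1) ≠ 0`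
the Manin-kept Gross–Zagier identity (k1-c3x Part 4: `ord₃ q + ord₃ q_d + ord₃∏c(E) + 2·ord₃#Wd_tors + 2·ord₃ c = 2M₀`,
`ord₃#Ш(E/K) = ord₃#Ш(E) + ord₃#Ш(Wd)`) and the halves (`ord₃ q = ord₃#Ш(E)`, `ord₃ q_d = ord₃#Ш(Wd) + ord₃∏c(Wd) − 2·ord₃#Wd_tors`) give
EXACTNESS `ord₃#Ш(E/K) + b = 2M₀`. If no level-`(M+1)` certificate existed, then every `P_n`, `n ∈ S(M+1)`, is `3^{M+1}`-divisible, and for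
`1 ≤ s ≤ M` every `P_n`, `n ∈ S(s)`, is `3^s`-divisible (else a level-`s` certificate and the LOWER half give `2(M₀ − s + 1) ≤ 2M₀ − b`, i.e.
`b ≤ 2s − 2 < b`); so the system is globally divisible to depth `M+1` and the UPPER half gives `2M + 2 ≤ b < 2M + 2` — contradiction. Class
level: Hoffstein–Luo gives an ODD split frame, the datum / embedding / `K`-rational Heegner point are PROVED `_holds` lemmas, the minimal twist
is a non-CM rank-zero leaf curve (`leaf_twist_of_heegner`), tower surjectivity forces non-CM (Zywina).

* §1 bookkeeping; §2–§3 `exists_certificateAt_of_bsdHalves` (POINTWISE: four halves at one split frame ⟹ `∃ M, 2M ≤ b ∧ CertificateAt … 3 M`);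
* §4 `certificatesOddFrame_of_members`, `gss2RankOneMcCallumCertificateAtThreeTower_of_members` (**A 27200 BY NAME ⟸ print ∧ L₁ ∧ U₁ ∧ L₀ ∧ U₀**),
  `certificates3Nn_of_members` (A₃ₙₙ stub text VERBATIM ⟸ the same); §5 `gss2RankOneMcCallumCertificateAtThreeTower_of_wAllExclAddGssAtThree` (**A ⟸ print ∧ leaf**).

References: [cite: MatarNekovar2019, Thm. 0.7 (p. 456) and §0.11 (p. 457)] [cite: McCallumLMS1991, §5 Lemma 5.1 (p. 303), Thm. 5.4 (p. 308), Cor. 5.6 (p. 310)]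
[cite: JetchevSkinnerWan2017, §7.4.1 (pp. 29–31)] [cite: GrossZagier1986, Thm. I.(6.3) and V.§2] [cite: HoffsteinLuo1997, Theorem (§1, pp. 435–436)]
[cite: Zywina2015, Prop. 1.14 and Prop. 1.16 (§1.9)] [cite: Darmon2004, Thm. 3.6] [cite: Miller2011LMS, Def. 1.1].
-/

-- D-0017: single-problem summit, so `Summit.BirchSwinnertonDyer.BirchSwinnertonDyer.…` repeats a namespace BY DESIGN.
set_option linter.dupNamespace false
set_option autoImplicit false

noncomputable section

open scoped Classical NumberField

open WeierstrassCurve NumberField IsDedekindDomain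
  Literature.NumberTheory.EllipticCurves Literature.NumberTheory.EllipticCurves.ModularForms
  Literature.NumberTheory.EllipticCurves.Rank1Residual
  Literature.NumberTheory.EllipticCurves.Rank1Residual.Typed
  Summit.BirchSwinnertonDyer.Rank1Residual
  Summit.BirchSwinnertonDyer.Rank1Residual.Additive
  Summit.BirchSwinnertonDyer.Rank1Residual.X11b
  Summit.BirchSwinnertonDyer.Rank1Residual.GaloisImage
  Summit.BirchSwinnertonDyer.BirchSwinnertonDyer.Theorems
  Summit.BirchSwinnertonDyer.BirchSwinnertonDyer.Theorems.AdditiveBranchIMCGordTwoRankOne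
  Summit.BirchSwinnertonDyer.BirchSwinnertonDyer.Theses.RamifiedHeegnerPair

namespace Summit.BirchSwinnertonDyer.BirchSwinnertonDyer.Theorems.RamifiedPairLowerBound

/-! ## §1 Bookkeeping: the two halves fix the valuations of `#Ш(E)_an` and of the twist's algebraic `L`-value -/

/-- **Both halves at `(W, p)` fix `ord_p #Ш(W)_an`**: if `#Ш(W)_an` is a rational with `ord_p ≤ ord_p #Ш(W)` and a rational with `ord_p ≥`, then
for ANY rational `q` with `#Ш(W)_an = q`, `ord_p q = ord_p #Ш(W)` (the rational is unique). Bookkeeping. [cite: Miller2011LMS, Def. 1.1] -/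
theorem padicValRat_shaAn_eq_of_lower_of_upper {W : WeierstrassCurve ℚ} {p : ℕ} (hl : MissingLowerBoundAt W p)
    (hu : MissingUpperBoundAt W p) {q : ℚ} (hq : shaAn W = (q : ℂ)) : padicValRat p q = padicValNat p W.shaOrder := by
  obtain ⟨q₁, hq₁, hle⟩ := hl
  obtain ⟨q₂, hq₂, hge⟩ := hu
  have h₁ : q₁ = q := by exact_mod_cast hq₁.symm.trans hq
  have h₂ : q₂ = q := by exact_mod_cast hq₂.symm.trans hq
  subst h₁ h₂
  exact le_antisymm hle hge

/-- **`MissingLowerBoundAt Wd p` at analytic rank `0`, in the `L(Wd,1)/Ω` currency** (mirror of `twist_le_half_of_missingUpperBoundAt`): if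
`L(Wd,1) ≠ 0` and `L(Wd,1)/Ω_{Wd} = q_d ∈ ℚ`, then `ord_p q_d ≤ ord_p #Ш(Wd) + ord_p ∏c(Wd) − 2·ord_p #Wd(ℚ)_tors` (`Reg = 1` by GZK at
`r_an = 0`; `#Ш_an = q_d·#tors²/∏c`). Bookkeeping. [cite: Miller2011LMS, Def. 1.1] -/
theorem twist_ge_half_of_missingLowerBoundAt
    (hGZK : rank_eq_analyticRank_of_analyticRank_le_one) (hmod : hasEntireLFunction_rat)
    (Wd : WeierstrassCurve ℚ) [Wd.IsElliptic] (p : ℕ) [Fact p.Prime]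
    (hL : Wd.entireLFunction 1 ≠ 0) (hLo : MissingLowerBoundAt Wd p)
    (qd : ℚ) (hqd : Wd.entireLFunction 1 / (Wd.realPeriodRat : ℂ) = (qd : ℂ)) :
    padicValRat p qd ≤ (padicValNat p Wd.shaOrder : ℤ) + padicValNat p Wd.tamagawaProduct -
      2 * padicValNat p Wd.torsionOrder := by
  -- adapted from `twist_le_half_of_missingUpperBoundAt` (IrreducibleRoad §5): same identities, the other inequality
  have hrd : Wd.analyticRank = 0 := (Wd.analyticRank_eq_zero_iff_holds (hmod Wd)).2 hL
  have hmw0 : Wd.mordellWeilRank = 0 := by rw [(hGZK Wd (by rw [hrd]; exact zero_le_one)).1, hrd]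
  have hΩpos : 0 < Wd.realPeriodRat := Wd.realPeriodRat_pos_holds
  have htpos : 0 < Wd.torsionOrder := Wd.torsionOrder_pos_holds
  have hcpos : 0 < Wd.tamagawaProduct := Wd.tamagawaProduct_pos_holds
  have hΩ : (Wd.realPeriodRat : ℂ) ≠ 0 := by exact_mod_cast hΩpos.ne'
  have ht : (Wd.torsionOrder : ℂ) ≠ 0 := by exact_mod_cast htpos.ne'
  have hc : (Wd.tamagawaProduct : ℂ) ≠ 0 := by exact_mod_cast hcpos.ne'
  obtain ⟨q, hq, hle⟩ := hLo
  rw [shaAn_def, Wd.leadingLCoeff_eq_of_analyticRank_eq_zero hrd, Wd.regulator_eq_one_of_rank_zero hmw0] at hq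
  simp only [Complex.ofReal_one, mul_one] at hq
  -- `L(Wd,1) = q_d · Ω`
  have hLq : Wd.entireLFunction 1 = (qd : ℂ) * (Wd.realPeriodRat : ℂ) := by
    rw [← hqd, div_mul_cancel₀ _ hΩ]
  -- `q_d ≠ 0`
  have hqd0 : qd ≠ 0 := by
    intro h0
    rw [h0] at hLq
    push_cast at hLq
    rw [zero_mul] at hLq
    exact hL hLq
  -- the rational identity `q = q_d · #tors² / ∏c`
  have htq : (Wd.torsionOrder : ℚ) ≠ 0 := by exact_mod_cast htpos.ne'
  have hcq : (Wd.tamagawaProduct : ℚ) ≠ 0 := by exact_mod_cast hcpos.ne'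
  have hqq : q = qd * (Wd.torsionOrder : ℚ) ^ 2 / (Wd.tamagawaProduct : ℚ) := by
    have h : ((qd * (Wd.torsionOrder : ℚ) ^ 2 / (Wd.tamagawaProduct : ℚ) : ℚ) : ℂ) = (q : ℂ) := by
      push_cast
      rw [← hq, hLq]
      field_simp
    exact_mod_cast h.symm
  have hval : padicValRat p q = padicValRat p qd + 2 * padicValNat p Wd.torsionOrder - padicValNat p Wd.tamagawaProduct := by
    rw [hqq, padicValRat.div (mul_ne_zero hqd0 (pow_ne_zero 2 htq)) hcq, padicValRat.mul hqd0 (pow_ne_zero 2 htq),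
      padicValRat.pow (Wd.torsionOrder : ℚ), padicValRat.of_nat, padicValRat.of_nat]
    simp only [Nat.cast_ofNat]
  rw [hval] at hle
  linarith

/-! ## §2–§3 POINTWISE: at one split Heegner frame, the four halves of BSD₃ force a certificate of adjusted depth -/

/-- **The four halves at a split frame ⟹ a McCallum certificate of adjusted BSD depth** (converse of the line's road at ONE frame). Frame:
`W/ℚ` globally minimal, NON-CM, Gss2 at `3`, `r_an = 1`; `K` imaginary quadratic Heegner for `N_W` with `L(W^{(d_K)},1) ≠ 0`; `P ∈ E(K)` over
the complex Heegner point of `(Dt, H, ι)`; `Wd = Cd • W^{(d_K)}` globally minimal. PRINT (hypotheses): `hGZ hKo hGZK hmod hrec h36` and the two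
Matar–Nekovář halves `hMNlo hMNup`. HALVES (hypotheses): `MissingLower/UpperBoundAt W 3`, `MissingLower/UpperBoundAt Wd 3`. CONCLUSION:
`∃ M, 2M ≤ ord₃∏c(W) + ord₃∏c(Wd) + 2·ord₃ c(Dt) ∧ Koly.CertificateAt Dt H.β ι 3 M` (`M = ⌊b/2⌋`; exactness `ord₃#Ш(E/K) + b = 2M₀`, then by
contradiction through both halves of the structure theorem — module docstring). [cite: MatarNekovar2019, Thm. 0.7 (p. 456) and §0.11 (p. 457)]
[cite: McCallumLMS1991, §5 Lemma 5.1 (p. 303) and Cor. 5.6 (p. 310)] [cite: JetchevSkinnerWan2017, §7.4.1 (pp. 29–31)] [cite: Darmon2004, Thm. 3.6] -/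
theorem exists_certificateAt_of_bsdHalves
    (W : WeierstrassCurve ℚ) [W.IsElliptic] [W.IsGloballyMinimal] [NeZero (W.conductorNorm ℤ)]
    (K : Type) [Field K] [NumberField K]
    (Dt : ModularParametrizationData W (W.conductorNorm ℤ))
    (H : HeegnerDatum (W.conductorNorm ℤ) (NumberField.discr K)) (ι : K →+* ℂ)
    (P : (W.baseChange K).toAffine.Point)
    (hGZ : gross_zagier (W.conductorNorm ℤ) W K) (hKo : kolyvagin (W.conductorNorm ℤ) W K)
    (hGZK : rank_eq_analyticRank_of_analyticRank_le_one) (hmod : hasEntireLFunction_rat)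
    (hrec : heegnerPointOfConductor_one_galoisConj (W.conductorNorm ℤ) W K)
    (h36 : phi_heegnerTau_mem_range_map_singularModuliField (W.conductorNorm ℤ) W K)
    (hMNlo : MatarNekovar2019.thm07_pow_dvd_card_sha_primary_of_certificate_of_irreducible)
    (hMNup : MatarNekovar2019.thm07_padicValNat_card_sha_primary_add_le_of_globalDivisibility_of_irreducible)
    (hCM : ¬ W.HasCM) (hadd : Addv W 3) (hsub : SubGss W 3) (hr : W.analyticRank = 1)
    (hK : IsImaginaryQuadratic K) (hHN : SatisfiesHeegnerHypothesis (W.conductorNorm ℤ) K)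
    (hP : WeierstrassCurve.Affine.Point.map ι.toRatAlgHom P = heegnerPointComplex Dt H)
    (hLt : (W.quadraticTwist (NumberField.discr K : ℚ)).entireLFunction 1 ≠ 0)
    (Wd : WeierstrassCurve ℚ) [Wd.IsElliptic] [Wd.IsGloballyMinimal] (Cd : VariableChange ℚ)
    (hWd : Cd • W.quadraticTwist (NumberField.discr K : ℚ) = Wd)
    (hL1 : MissingLowerBoundAt W 3) (hU1 : MissingUpperBoundAt W 3)
    (hL0 : MissingLowerBoundAt Wd 3) (hU0 : MissingUpperBoundAt Wd 3) :
    ∃ M : ℕ, (2 * M : ℤ) ≤ padicValNat 3 W.tamagawaProduct + padicValNat 3 Wd.tamagawaProduct +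
        2 * padicValRat 3 (Dt.c : ℚ) ∧ Three.Koly.CertificateAt Dt H.β ι 3 M := by
  -- frame facts, adapted from IrreducibleRoad §8 (`missingLowerBoundAt_three_rankOne_gss_of_structIrrCertificate_of_upperTwist`)
  have hp2 : (3 : ℕ) ≠ 2 := by decide
  have h3N : 3 ∣ W.conductorNorm ℤ := (W.dvd_conductorNorm_iff_not_hasGoodReductionAtPrime 3).mpr (not_good_of_addv W 3 hadd)
  obtain ⟨hd3, hμ⟩ := X11b.Three.not_dvd_discr_and_not_dvd_torsionOrder_of_heegner hK hHN hp2 h3N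
  have h3 : NumberField.discr K ≠ -3 := fun h ↦ hd3 (h ▸ ⟨-1, by norm_num⟩)
  have h4 : NumberField.discr K ≠ -4 := by
    intro hK4
    have h12 : (3 : ℤ) ∣ 4 * (W.conductorNorm ℤ : ℤ) := Dvd.dvd.mul_left (by exact_mod_cast h3N) 4
    have h3d : (3 : ℤ) ∣ H.β ^ 2 - NumberField.discr K := dvd_trans h12 H.dvd_sq_sub
    have hcast : ((H.β ^ 2 - NumberField.discr K : ℤ) : ZMod 3) = 0 :=
      (ZMod.intCast_zmod_eq_zero_iff_dvd _ 3).mpr h3d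
    have hdK : ((NumberField.discr K : ℤ) : ZMod 3) = -4 := by rw [hK4]; push_cast; ring
    push_cast at hcast
    rw [hdK] at hcast
    have key : ∀ b : ZMod 3, b ^ 2 - (-4 : ZMod 3) ≠ 0 := by decide
    exact key _ hcast
  haveI h3p : Fact (Nat.Prime 3) := ⟨Nat.prime_three⟩
  have hirr : Irr W 3 := irr_of_subGss_of_ne_two W 3 hp2 hadd hsub
  -- the conductor-`1` Kolyvagin–Heegner datum with `P_1 = y_K = P` in `E(K̄)`
  obtain ⟨d₁⟩ := nonempty_kolyvaginHeegnerData_one_of_darmon36 h36 hK Dt H.β ι H.dvd_sq_sub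
  have hPd : d₁.toGeomPoints d₁.derivedPoint = toGeomPoints (W.baseChange K) P :=
    KolyvaginBottom.toGeomPoints_derivedPoint_one_eq hrec hK hHN hP d₁ rfl
  -- `P` non-torsion (Gross–Zagier), rank one and `Ш(E/K)` finite (Kolyvagin)
  have hPinf : ¬ IsOfFinAddOrder P :=
    not_isOfFinAddOrder_of_heegner_of_analyticRank_eq_one W (W.conductorNorm ℤ) K Dt H ι P hGZ hmod hr hK hHN hLt hP
  obtain ⟨hrank, hSha⟩ := hKo hK hHN ⟨Dt, H, ι, hP⟩ hPinf
  haveI : Finite (W.baseChange K).sha := hSha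
  -- `E(K)[3] = 0`
  have hbot := torsionBy_eq_bot_of_isImaginaryQuadratic_of_hasIrreducibleModPGaloisRep W K hK Nat.prime_three hirr
  have hiv : ∀ x : (W.baseChange K).toAffine.Point, (3 : ℕ) • x = 0 → x = 0 := fun x hx ↦ by
    have hmem : x ∈ AddSubgroup.torsionBy (W.baseChange K).toAffine.Point (((3 : ℕ) : ℕ) : ℤ) := by
      rw [mem_torsionBy_iff, natCast_zsmul]; exact hx
    rwa [hbot] at hmem
  -- `3^{M₀} ∥ P` in `E(K)`
  haveI : Module.Finite ℤ (W.baseChange K).toAffine.Point := (W.baseChange K).module_finite_point_holds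
  obtain ⟨M₀, x₀, hx₀, hmax⟩ := exists_pow_smul_eq_and_forall_ne hPinf (p := 3) Nat.prime_three.two_le
  have hdiv : ∃ Q : (W.baseChange K).toAffine.Point, ((3 ^ M₀ : ℕ) : ℤ) • Q = P := ⟨x₀, by rw [natCast_zsmul]; exact hx₀⟩
  have hndiv : ¬ ∃ Q : (W.baseChange K).toAffine.Point, ((3 ^ (M₀ + 1) : ℕ) : ℤ) • Q = P := by
    rintro ⟨Q, hQ⟩; exact hmax Q (by rw [← natCast_zsmul]; exact hQ)
  -- `ord₃[E(K):ℤP] = M₀` (McCallum Lemma 5.1) and `ord₃#Ш(E/K) = ord₃#Ш(E/K)[3^∞]`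
  haveI : Finite (AddCommGroup.torsion (W.baseChange K).toAffine.Point) :=
    WeierstrassCurve.finite_torsion_point (W := W.baseChange K)
  obtain ⟨c, Q, hcQ, hcker⟩ := RankOne.exists_coord_of_mordellWeilRank_eq_one (W.baseChange K) hrank
  have hidx : padicValNat 3 (AddSubgroup.zmultiples P).index = M₀ :=
    Three.Koly.padicValNat_index_zmultiples_eq_of_divisibility c Q hcQ hcker hiv P hdiv hndiv
  have hshaK : padicValNat 3 (W.baseChange K).shaOrder =
      padicValNat 3 (Nat.card (AddCommGroup.primaryComponent (W.baseChange K).sha 3)) :=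
    Three.Koly.padicValNat_shaOrder_eq (W.baseChange K) 3
  ---------------------------------------------------------------- §2 EXACTNESS `ord₃#Ш(E/K) + b = 2M₀`
  have hD0 : (NumberField.discr K : ℚ) ≠ 0 := by exact_mod_cast NumberField.discr_ne_zero K
  haveI hEt : (W.quadraticTwist (NumberField.discr K : ℚ)).IsElliptic := W.isElliptic_quadraticTwist hD0
  have hu : padicValRat 3 (Cd.u : ℚ) = 0 :=
    HeegnerKolyvagin.padicValRat_u_eq_zero_of_twist_minimal' W 3 K hK hHN hadd.1 Cd hWd
  have hLt' : (W.quadraticTwist (NumberField.discr K : ℚ)).entireLFunction = Wd.entireLFunction := by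
    rw [← hWd, entireLFunction_smul]
  have hLd1 : Wd.entireLFunction 1 ≠ 0 := by rw [← hLt']; exact hLt
  -- the twist's algebraic `L`-value and its valuation from U₀(Wd) ∧ L₀(Wd)
  obtain ⟨qd, hqd, hvqd⟩ := twist_le_half_of_missingUpperBoundAt hGZK hmod Wd 3 hLd1 hU0
  have hvqd' := twist_ge_half_of_missingLowerBoundAt hGZK hmod Wd 3 hLd1 hL0 qd hqd
  -- the Manin-kept Gross–Zagier bookkeeping identity (k1-c3x Part 4)
  obtain ⟨-, -, hsha, q, hq, hval⟩ := HeegnerKolyvagin.exists_shaAn_padicVal_eq_of_heegner_maninKept W 3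
    (W.conductorNorm ℤ) K Dt H ι P hGZ hKo hGZK hmod hK hHN hP hp2 hμ hr hLt Wd Cd hWd hu qd hqd
  -- `ord₃ q = ord₃#Ш(W)` from L₁(W) ∧ U₁(W)
  have hvq : padicValRat 3 q = padicValNat 3 W.shaOrder := padicValRat_shaAn_eq_of_lower_of_upper hL1 hU1 hq
  -- the budget as a natural number
  obtain ⟨b, hb⟩ : ∃ b : ℕ, (b : ℤ) = padicValNat 3 W.tamagawaProduct + padicValNat 3 Wd.tamagawaProduct +
      2 * padicValRat 3 (Dt.c : ℚ) :=
    ⟨padicValNat 3 W.tamagawaProduct + padicValNat 3 Wd.tamagawaProduct + 2 * padicValInt 3 Dt.c, by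
      rw [padicValRat.of_int]; push_cast; ring⟩
  -- exactness
  have hexact : padicValNat 3 (Nat.card (AddCommGroup.primaryComponent (W.baseChange K).sha 3)) + b = 2 * M₀ := by
    have e1 : (padicValNat 3 (W.baseChange K).shaOrder : ℤ) = padicValNat 3 W.shaOrder + padicValNat 3 Wd.shaOrder := by
      exact_mod_cast hsha
    have e2 : (padicValNat 3 (Nat.card (AddCommGroup.primaryComponent (W.baseChange K).sha 3)) : ℤ) + b = 2 * M₀ := by
      rw [← hshaK, hb, ← hidx]
      linarith
    exact_mod_cast e2
  ---------------------------------------------------------------- §3 the certificate at level `M = ⌊b/2⌋`, by contradiction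
  refine ⟨b / 2, ?_, ?_⟩
  · rw [← hb]
    norm_cast
    omega
  by_contra hno
  -- global divisibility to depth `b/2 + 1`
  have hglob : ∀ (s : ℕ), s ≤ b / 2 + 1 → ∀ (n : ℕ) (d : KolyvaginHeegnerData Dt H.β ι n), Squarefree n →
      (∀ ℓ ∈ n.primeFactors, Zhang2014.IsKolyvaginPrime (W.conductorNorm ℤ) W K 3 ℓ ∧
        s ≤ Zhang2014.kolyvaginIndex W 3 ℓ) →
      ∃ Q : (W.baseChange (ringClassField K ι n)).toAffine.Point, ((3 ^ s : ℕ) : ℤ) • Q = d.derivedPoint := by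
    intro s hs n d hn hℓ
    by_contra hQ
    rcases Nat.eq_zero_or_pos s with rfl | hspos
    · exact hQ ⟨d.derivedPoint, by rw [pow_zero, Nat.cast_one, one_zsmul]⟩
    obtain ⟨s', rfl⟩ := Nat.exists_eq_add_one_of_ne_zero hspos.ne'
    by_cases hs' : s' = b / 2
    · -- `s = M + 1`: `(n, P_n)` would be a level-`(M+1)` certificate
      subst hs'
      exact hno ⟨n, n.primeFactors.card, d, ⟨hn, rfl, hℓ⟩, hQ⟩
    · -- `s ≤ M`: a level-`s` certificate contradicts exactness through the LOWER half of the structure theorem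
      have hs'M : s' < b / 2 := by omega
      have hle := two_mul_sub_le_padicValNat_card_sha_primary_of_certificate_of_structIrr hMNlo W hCM K hK h3 h4 hHN 3 hp2 hirr
        Dt H.β ι d₁ P hPd hPinf hdiv hndiv d hn hℓ hQ
      omega
  -- the UPPER half of the structure theorem at depth `b/2 + 1`
  have hup := hMNup W hCM K hK h3 h4 hHN 3 hp2 hirr Dt H.β ι d₁ P hPd hPinf M₀ hdiv hndiv (b / 2 + 1) hglob
  omega

/-! ## §4 CLASS LEVEL: A 27200 and A₃ₙₙ from the four members of the route (print displayed) -/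

/-- **Every NON-CM Gss2 rank-one row has an ODD split Heegner frame with a certificate of adjusted BSD depth, GIVEN the four member halves**
(L₁ 26021, U₁ 26022, L₀ 26023, U₀ 26024 BY NAME) and PRINT: Gross–Zagier, Kolyvagin, GZK, modularity, newforms `hnf`, Hoffstein–Luo `hHL` (odd
split frame with `L(E^{(d_K)},1) ≠ 0`), the parametrisation `hmodP`, Shimura reciprocity `hrec`, Darmon Thm. 3.6 `h36`, both Matar–Nekovář halves;
the Heegner datum / embedding / `K`-rational Heegner point are PROVED `_holds` lemmas, the minimal twist is a non-CM rank-zero leaf curve.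
[cite: HoffsteinLuo1997, Theorem (§1, pp. 435–436)] [cite: Darmon2004, Thm. 3.6] [cite: MatarNekovar2019, Thm. 0.7 (p. 456) and §0.11 (p. 457)] -/
theorem certificatesOddFrame_of_members
    (hGZ : ∀ (N : ℕ) [NeZero N] (W : WeierstrassCurve ℚ) (K : Type) [Field K] [NumberField K], gross_zagier N W K)
    (hKo : ∀ (N : ℕ) [NeZero N] (W : WeierstrassCurve ℚ) (K : Type) [Field K] [NumberField K], kolyvagin N W K)
    (hGZK : rank_eq_analyticRank_of_analyticRank_le_one) (hmod : hasEntireLFunction_rat) (hnf : exists_isNewformOf)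
    (hHL : HoffsteinLuo1997_exists_twist_L_one_ne_zero) (hmodP : nonempty_modularParametrizationData)
    (hrec : ∀ (N : ℕ) [NeZero N] (W : WeierstrassCurve ℚ) (K : Type) [Field K] [NumberField K],
      heegnerPointOfConductor_one_galoisConj N W K)
    (h36 : ∀ (N : ℕ) [NeZero N] (W : WeierstrassCurve ℚ) (K : Type) [Field K] [NumberField K],
      phi_heegnerTau_mem_range_map_singularModuliField N W K)
    (hMNlo : MatarNekovar2019.thm07_pow_dvd_card_sha_primary_of_certificate_of_irreducible)
    (hMNup : MatarNekovar2019.thm07_padicValNat_card_sha_primary_add_le_of_globalDivisibility_of_irreducible)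
    (hL1 : Gss2LowerAtThreeRankOne) (hU1 : LeafRankOneUpperAtThree) (hL0 : Gss2LowerAtThreeRankZero) (hU0 : LeafRankZeroUpperAtThree) :
    ∀ (W : WeierstrassCurve ℚ) [W.IsElliptic] [W.IsGloballyMinimal], ¬ W.HasCM →
      Literature.NumberTheory.EllipticCurves.Rank1Residual.Addv W 3 → Summit.BirchSwinnertonDyer.Rank1Residual.Additive.SubGss W 3 →
      W.analyticRank = 1 →
      ∃ (N : ℕ) (_ : NeZero N) (K : Type) (_ : Field K) (_ : NumberField K)
        (Dt : Literature.NumberTheory.EllipticCurves.ModularForms.ModularParametrizationData W N)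
        (H : Literature.NumberTheory.EllipticCurves.HeegnerDatum N (NumberField.discr K)) (ι : K →+* ℂ)
        (P : (W.baseChange K).toAffine.Point) (Wd : WeierstrassCurve ℚ) (_ : Wd.IsElliptic) (_ : Wd.IsGloballyMinimal)
        (Cd : WeierstrassCurve.VariableChange ℚ) (M : ℕ),
        W.conductorNorm ℤ = N ∧ Literature.NumberTheory.EllipticCurves.IsImaginaryQuadratic K ∧ Odd (NumberField.discr K) ∧
        Literature.NumberTheory.EllipticCurves.SatisfiesHeegnerHypothesis N K ∧
        (W.quadraticTwist (NumberField.discr K : ℚ)).entireLFunction 1 ≠ 0 ∧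
        WeierstrassCurve.Affine.Point.map ι.toRatAlgHom P = Literature.NumberTheory.EllipticCurves.ModularForms.heegnerPointComplex Dt H ∧
        Cd • W.quadraticTwist (NumberField.discr K : ℚ) = Wd ∧
        (2 * M : ℤ) ≤ padicValNat 3 W.tamagawaProduct + padicValNat 3 Wd.tamagawaProduct + 2 * padicValRat 3 (Dt.c : ℚ) ∧
        Summit.BirchSwinnertonDyer.Rank1Residual.X11b.Three.Koly.CertificateAt Dt H.β ι 3 M := by
  intro W _ _ hCM hadd hsub hr
  haveI h3p : Fact (Nat.Prime 3) := ⟨Nat.prime_three⟩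
  haveI hN0 : NeZero (W.conductorNorm ℤ) := ⟨(W.conductorNorm_pos_holds).ne'⟩
  -- an ODD split Heegner frame with `L(E^{(d_K)},1) ≠ 0` (Hoffstein–Luo; root number `−1` by modularity)
  have hw : W.rootNumber = -1 := by
    rw [WeierstrassCurve.rootNumber_eq_neg_one_pow_analyticRank_of_exists_isNewformOf hnf W, hr]
    norm_num
  obtain ⟨K, _, _, hK, hodd, hHN, -, hLt⟩ := exists_heegnerField_odd_split_twist_ne_zero_of_hoffsteinLuo hnf hHL W hw 3
  -- the parametrisation, the Heegner datum, an embedding, and the `K`-rational Heegner point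
  obtain ⟨Dt⟩ := hmodP W
  obtain ⟨β, hβ⟩ := exists_dvd_sq_sub_discr_holds (W.conductorNorm ℤ) K hK hHN
  obtain ⟨H, -⟩ := nonempty_heegnerDatum_holds (W.conductorNorm ℤ) K hK hβ
  obtain ⟨ι⟩ : Nonempty (K →+* ℂ) := inferInstance
  obtain ⟨P, hP⟩ := heegnerPointComplex_mem_range_map_holds (W.conductorNorm ℤ) W K hK hHN Dt H ι
  -- a globally minimal model of the twist: a non-CM rank-zero LEAF curve
  have hD0 : (NumberField.discr K : ℚ) ≠ 0 := by exact_mod_cast NumberField.discr_ne_zero K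
  haveI hEt : (W.quadraticTwist (NumberField.discr K : ℚ)).IsElliptic := W.isElliptic_quadraticTwist hD0
  obtain ⟨Cd, hCd⟩ := hasGlobalMinimalModel_rat_holds (W.quadraticTwist (NumberField.discr K : ℚ))
  haveI : (Cd • W.quadraticTwist (NumberField.discr K : ℚ)).IsGloballyMinimal := hCd
  have hrd : (Cd • W.quadraticTwist (NumberField.discr K : ℚ)).analyticRank = 0 := by
    rw [analyticRank_smul]
    exact analyticRank_eq_zero_of_entireLFunction_one_ne_zero _ hLt
  obtain ⟨hCMd, haddd, hsubd, -⟩ := RamifiedPairUpperBound.leaf_twist_of_heegner W hCM hadd hsub K hK hHN hodd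
    (Cd • W.quadraticTwist (NumberField.discr K : ℚ)) Cd rfl
  -- the four halves at the pair, and the pointwise theorem
  obtain ⟨M, hM, hcert⟩ := exists_certificateAt_of_bsdHalves W K Dt H ι P (hGZ _ W K) (hKo _ W K) hGZK hmod (hrec _ W K)
    (h36 _ W K) hMNlo hMNup hCM hadd hsub hr hK hHN hP hLt (Cd • W.quadraticTwist (NumberField.discr K : ℚ)) Cd rfl
    (hL1 W hCM hadd hsub hr) (hU1 W hCM hadd hsub hr) (hL0 _ hCMd haddd hsubd hrd) (hU0 _ hCMd haddd hsubd hrd)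
  exact ⟨W.conductorNorm ℤ, hN0, K, inferInstance, inferInstance, Dt, H, ι, P, Cd • W.quadraticTwist (NumberField.discr K : ℚ),
    inferInstance, inferInstance, Cd, M, rfl, hK, hodd, hHN, hLt, hP, rfl, hM, hcert⟩

/-- **A 27200 `Gss2RankOneMcCallumCertificateAtThreeTower` BY NAME ⟸ PUB 27199 ∧ `hmodP` ∧ MN± ∧ L₁ 26021 ∧ U₁ 26022 ∧ L₀ 26023 ∧ U₀ 26024** —
the crux is TIGHT (no surplus over the four members modulo print). PUB supplies Gross–Zagier, Kolyvagin, GZK, modularity, newforms, Hoffstein–Luo,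
Shimura reciprocity and Darmon Thm. 3.6 (its Kolyvagin-bound, McCallum and Kato conjuncts are not used); tower surjectivity (already mod `3`) forces
non-CM (Zywina 2015 Prop. 1.14/1.16); the rest is `certificatesOddFrame_of_members` with the oddness of the frame forgotten.
[cite: Zywina2015, Prop. 1.14 and Prop. 1.16 (§1.9)] [cite: HoffsteinLuo1997, Theorem (§1, pp. 435–436)]
[cite: MatarNekovar2019, Thm. 0.7 (p. 456) and §0.11 (p. 457)] [cite: McCallumLMS1991, §5 Cor. 5.6 (p. 310)] -/
theorem gss2RankOneMcCallumCertificateAtThreeTower_of_members (hpub : Gss2LowerPrintedInputsAtThree)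
    (hmodP : nonempty_modularParametrizationData)
    (hMNlo : MatarNekovar2019.thm07_pow_dvd_card_sha_primary_of_certificate_of_irreducible)
    (hMNup : MatarNekovar2019.thm07_padicValNat_card_sha_primary_add_le_of_globalDivisibility_of_irreducible)
    (hL1 : Gss2LowerAtThreeRankOne) (hU1 : LeafRankOneUpperAtThree) (hL0 : Gss2LowerAtThreeRankZero) (hU0 : LeafRankZeroUpperAtThree) :
    Gss2RankOneMcCallumCertificateAtThreeTower := by
  obtain ⟨⟨hGZ, hKo, -, hGZK, hmod, hnf, hHL, hrec, -, h36⟩, -⟩ := hpub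
  intro W _ _ hadd hsub hr hsurj
  haveI h3p : Fact (Nat.Prime 3) := ⟨Nat.prime_three⟩
  have hs3 : W.HasSurjectiveModNGaloisRep 3 := by simpa using hsurj 1
  have hCM : ¬ W.HasCM := fun hcm ↦ W.not_hasSurjectiveModNGaloisRep_of_hasCM hcm Nat.prime_three (by norm_num) hs3
  obtain ⟨N, hN0, K, _, _, Dt, H, ι, P, Wd, _, _, Cd, M, hN, hK, -, hHN, hLt, hP, hWd, hM, hcert⟩ :=
    certificatesOddFrame_of_members hGZ hKo hGZK hmod hnf hHL hmodP hrec h36 hMNlo hMNup hL1 hU1 hL0 hU0 W hCM hadd hsub hr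
  exact ⟨N, hN0, K, inferInstance, inferInstance, Dt, H, ι, P, Wd, inferInstance, inferInstance, Cd, M, hN, hK, hHN, hLt, hP, hWd,
    hM, hcert⟩

/-- **The A₃ₙₙ stub text (`stub_existsMcCallumCertificate_nonsplitRows` of skeleton v5, VERBATIM) ⟸ PUB ∧ `hmodP` ∧ MN± ∧ L₁ ∧ U₁ ∧ L₀ ∧ U₀**
— the `3Nn` certificate statement is TIGHT as well (the non-surjectivity binder is simply not used). [cite: HoffsteinLuo1997, Theorem (§1, pp. 435–436)]
[cite: MatarNekovar2019, Thm. 0.7 (p. 456) and §0.11 (p. 457)] [cite: McCallumLMS1991, §5 Cor. 5.6 (p. 310)] -/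
theorem certificates3Nn_of_members (hpub : Gss2LowerPrintedInputsAtThree) (hmodP : nonempty_modularParametrizationData)
    (hMNlo : MatarNekovar2019.thm07_pow_dvd_card_sha_primary_of_certificate_of_irreducible)
    (hMNup : MatarNekovar2019.thm07_padicValNat_card_sha_primary_add_le_of_globalDivisibility_of_irreducible)
    (hL1 : Gss2LowerAtThreeRankOne) (hU1 : LeafRankOneUpperAtThree) (hL0 : Gss2LowerAtThreeRankZero) (hU0 : LeafRankZeroUpperAtThree) :
    ∀ (W : WeierstrassCurve ℚ) [W.IsElliptic] [W.IsGloballyMinimal], ¬ W.HasCM →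
      Literature.NumberTheory.EllipticCurves.Rank1Residual.Addv W 3 → Summit.BirchSwinnertonDyer.Rank1Residual.Additive.SubGss W 3 →
      W.analyticRank = 1 → ¬ W.HasSurjectiveModNGaloisRep 3 →
      ∃ (N : ℕ) (_ : NeZero N) (K : Type) (_ : Field K) (_ : NumberField K)
        (Dt : Literature.NumberTheory.EllipticCurves.ModularForms.ModularParametrizationData W N)
        (H : Literature.NumberTheory.EllipticCurves.HeegnerDatum N (NumberField.discr K)) (ι : K →+* ℂ)
        (P : (W.baseChange K).toAffine.Point) (Wd : WeierstrassCurve ℚ) (_ : Wd.IsElliptic) (_ : Wd.IsGloballyMinimal)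
        (Cd : WeierstrassCurve.VariableChange ℚ) (M : ℕ),
        W.conductorNorm ℤ = N ∧ Literature.NumberTheory.EllipticCurves.IsImaginaryQuadratic K ∧ Odd (NumberField.discr K) ∧
        Literature.NumberTheory.EllipticCurves.SatisfiesHeegnerHypothesis N K ∧
        (W.quadraticTwist (NumberField.discr K : ℚ)).entireLFunction 1 ≠ 0 ∧
        WeierstrassCurve.Affine.Point.map ι.toRatAlgHom P = Literature.NumberTheory.EllipticCurves.ModularForms.heegnerPointComplex Dt H ∧
        Cd • W.quadraticTwist (NumberField.discr K : ℚ) = Wd ∧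
        (2 * M : ℤ) ≤ padicValNat 3 W.tamagawaProduct + padicValNat 3 Wd.tamagawaProduct + 2 * padicValRat 3 (Dt.c : ℚ) ∧
        Summit.BirchSwinnertonDyer.Rank1Residual.X11b.Three.Koly.CertificateAt Dt H.β ι 3 M := by
  obtain ⟨⟨hGZ, hKo, -, hGZK, hmod, hnf, hHL, hrec, -, h36⟩, -⟩ := hpub
  exact fun W _ _ hCM hadd hsub hr _ ↦
    certificatesOddFrame_of_members hGZ hKo hGZK hmod hnf hHL hmodP hrec h36 hMNlo hMNup hL1 hU1 hL0 hU0 W hCM hadd hsub hr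

/-! ## §5 … and from the LEAF itself -/

/-- **A 27200 BY NAME ⟸ PUB 27199 ∧ `hmodP` ∧ MN± ∧ the leaf `WAllExclAddGssAtThree`**: BSD₃ on the Gss2 leaf gives the four member halves
(`Typed.missingPPartAt_of_bsdp`, `Ш` finite by GZK), and §4 applies. So the load-bearing stub of the L₁ line is implied by the target of the column
modulo print — it has NO surplus (BC7 / criterion (ii)); with p618012 §12 (`A ∧ U₀-print ⟹ L₁|tower`) the crux A is EXACTLY the Heegner-side content
of BSD₃ on the tower rows. [cite: Miller2011LMS, Def. 1.1] [cite: MatarNekovar2019, Thm. 0.7 (p. 456) and §0.11 (p. 457)] [cite: McCallumLMS1991, §5 Cor. 5.6 (p. 310)]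
[cite: HoffsteinLuo1997, Theorem (§1, pp. 435–436)] -/
theorem gss2RankOneMcCallumCertificateAtThreeTower_of_wAllExclAddGssAtThree (hpub : Gss2LowerPrintedInputsAtThree)
    (hmodP : nonempty_modularParametrizationData)
    (hMNlo : MatarNekovar2019.thm07_pow_dvd_card_sha_primary_of_certificate_of_irreducible)
    (hMNup : MatarNekovar2019.thm07_padicValNat_card_sha_primary_add_le_of_globalDivisibility_of_irreducible)
    (hleaf : Summit.BirchSwinnertonDyer.WAllExclAddGssAtThree) :
    Gss2RankOneMcCallumCertificateAtThreeTower := by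
  have hGZK : rank_eq_analyticRank_of_analyticRank_le_one := hpub.1.2.2.2.1
  -- the four member halves from BSD₃ on the leaf
  have halves : ∀ (V : WeierstrassCurve ℚ) [V.IsElliptic] [V.IsGloballyMinimal], ¬ V.HasCM → Addv V 3 → SubGss V 3 →
      V.analyticRank ≤ 1 → MissingLowerBoundAt V 3 ∧ MissingUpperBoundAt V 3 := by
    intro V _ _ hCMV haddV hsubV hrV
    haveI : Finite V.sha := (hGZK V hrV).2
    exact Typed.lower_and_upper_of_missingPPartAt V 3 (Typed.missingPPartAt_of_bsdp V 3 (hleaf V hCMV haddV hsubV hrV))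
  exact gss2RankOneMcCallumCertificateAtThreeTower_of_members hpub hmodP hMNlo hMNup
    (fun V _ _ hCMV haddV hsubV hrV ↦ (halves V hCMV haddV hsubV (le_of_eq hrV)).1)
    (fun V _ _ hCMV haddV hsubV hrV ↦ (halves V hCMV haddV hsubV (le_of_eq hrV)).2)
    (fun V _ _ hCMV haddV hsubV hrV ↦ (halves V hCMV haddV hsubV (by rw [hrV]; exact zero_le_one)).1)
    (fun V _ _ hCMV haddV hsubV hrV ↦ (halves V hCMV haddV hsubV (by rw [hrV]; exact zero_le_one)).2)

end Summit.BirchSwinnertonDyer.BirchSwinnertonDyer.Theorems.RamifiedPairLowerBound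

end
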